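import Summits.KontsevichZagierPeriods.KontsevichZagierPeriods.Theorems.SymplecticScissorsRealOnePeriodRelationsStubNormalisationGlue

/-!
# `RealOnePeriodRelations` (stmt-KontsevichZagierPeriods-10042), line `nash-retraction-thin-strip`,
# reshape 3 (the unconditional rational layer): the stub `stub_layerGlue`

`RationalLayer.stub_layerGlue` is the glue `NormalisationGlue.normalisation_of` made parametric: the
generating set `H₁` is replaced by an arbitrary `G : Set KZ.FormalRep`, the cell condition "domain `= (0,1)`
and smooth integrand" by an arbitrary cell predicate `Qc`, and a symbol predicate `Ps` is threaded from
the per-cell combinations `C_ρ` to the glued combination `C := Σ_{ρ ∈ supp N} (N ρ : ℂ) • C_ρ` (supports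
are preserved: `supp C ⊆ ⋃_ρ supp C_ρ`, `Finsupp.support_finsetSum` and `Finsupp.support_smul`).
Everything else — the chosen realisations `Θ b s` (from `stub_realises`), additivity modulo `M₁`
(`RetractionAlgebra` §3), the class map `π`, and the value identity via soundness of `M₁`
(`eval_eq_zero_of_mem_M₁`) — is the bookkeeping of `NormalisationGlue.normalisation_of`.

References: A. Huber, G. Wüstholz, *Transcendence and Linear Relations of 1-Periods* (2022),
Prop. 12.5, Cor. 12.7; M. Kontsevich, D. Zagier, *Periods* (2001), §1.2.
-/

noncomputable section

open scoped BigOperators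
open Set MeasureTheory MvPolynomial
open Literature.NumberTheory.Transcendental Literature.NumberTheory.Transcendental.CurvePeriods
open Literature.ModelTheory.ExponentialFields (IsSemialgebraic)
open Summit.KontsevichZagierPeriods.SymplecticScissors.RealOnePeriodRelationsNegative (M₁ H₁ unitDom
  eval_eq_zero_of_mem_M₁)

namespace Summit.KontsevichZagierPeriods.SymplecticScissors.RealOnePeriodRelations

namespace RationalLayer

/-- **The glue with support predicates** (stub `stub_layerGlue` of the rational layer): if every `c` in
the subgroup generated by `G` is, modulo `M₁`, a `ℤ`-combination of `Qc`-cells, and every `Qc`-cell is,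
modulo `M₁`, an algebraic combination of real realisations of `Ps`-symbols along semialgebraic paths with
the same value, then every such `c` is, modulo `M₁`, a sum of real realisations of an algebraic
combination `C` of `Ps`-symbols with `evalCombination C = eval c`.
[cite: HuberWustholz2022, Prop. 12.5 and Cor. 12.7] -/
theorem stub_layerGlue : ∀ (G : Set KZ.FormalRep) (Qc : KZ.IntegralRep 1 → Prop) (Ps : PeriodSymbol → Prop),
    (∀ c : KZ.FormalRep, c ∈ AddSubgroup.closure G →
      ∃ N : KZ.IntegralRep 1 →₀ ℤ, (∀ ρ ∈ N.support, Qc ρ) ∧ c - N.sum (fun ρ m => m • KZ.of ρ) ∈ M₁) →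
    (∀ ρ : KZ.IntegralRep 1, Qc ρ →
      ∃ (C : PeriodSymbol →₀ ℂ) (R : PeriodSymbol → KZ.IntegralRep 1), (∀ s, IsAlgebraic ℚ (C s)) ∧
        (∀ s ∈ C.support, Ps s) ∧
        (∀ s ∈ C.support, IsSemialgebraicMapOn ℚ {z : Fin 1 → ℝ | z 0 ∈ Set.Icc (0 : ℝ) 1}
          (fun z => Fin.append (fun i => (s.γ.toFun (z 0) i).re) (fun i => (s.γ.toFun (z 0) i).im))) ∧
        (∀ s ∈ C.support, (R s).domain = {z | z 0 ∈ Set.Ioo (0 : ℝ) 1} ∧ ∀ z ∈ (R s).domain, (R s).integrand z =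
          (C s * ∑ i, MvPolynomial.eval (s.γ.toFun (z 0)) (s.ω i) * deriv (fun u => s.γ.toFun u i) (z 0)).re) ∧
        evalCombination C = ((ρ.value : ℝ) : ℂ) ∧ KZ.of ρ - ∑ s ∈ C.support, KZ.of (R s) ∈ M₁) →
    ∀ c : KZ.FormalRep, c ∈ AddSubgroup.closure G →
    ∃ (C : PeriodSymbol →₀ ℂ) (R : PeriodSymbol → KZ.IntegralRep 1), (∀ s, IsAlgebraic ℚ (C s)) ∧
      (∀ s ∈ C.support, Ps s) ∧
      (∀ s ∈ C.support, IsSemialgebraicMapOn ℚ {z : Fin 1 → ℝ | z 0 ∈ Set.Icc (0 : ℝ) 1}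
        (fun z => Fin.append (fun i => (s.γ.toFun (z 0) i).re) (fun i => (s.γ.toFun (z 0) i).im))) ∧
      (∀ s ∈ C.support, (R s).domain = {z | z 0 ∈ Set.Ioo (0 : ℝ) 1} ∧ ∀ z ∈ (R s).domain, (R s).integrand z =
        (C s * ∑ i, MvPolynomial.eval (s.γ.toFun (z 0)) (s.ω i) * deriv (fun u => s.γ.toFun u i) (z 0)).re) ∧
      evalCombination C = ((KZ.eval c : ℝ) : ℂ) ∧ c - ∑ s ∈ C.support, KZ.of (R s) ∈ M₁ := by
  classical
  intro G Qc Ps hcells harcs c hc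
  ------------------------------------------------------------------
  -- Step 0: chosen realisations `rc b s` for algebraic `b` and semialgebraic `s.γ`; the map `Θ`
  ------------------------------------------------------------------
  have hex : ∀ (b : ℂ) (s : PeriodSymbol),
      IsAlgebraic ℚ b ∧ IsSemialgebraicMapOn ℚ {z : Fin 1 → ℝ | z 0 ∈ Set.Icc (0 : ℝ) 1}
        (fun z => Fin.append (fun i => (s.γ.toFun (z 0) i).re) (fun i => (s.γ.toFun (z 0) i).im)) →
      ∃ r : KZ.IntegralRep 1, r.domain = {z | z 0 ∈ Set.Ioo (0 : ℝ) 1} ∧ ∀ z ∈ r.domain, r.integrand z =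
        (b * ∑ i, MvPolynomial.eval (s.γ.toFun (z 0)) (s.ω i) * deriv (fun u => s.γ.toFun u i) (z 0)).re :=
    fun b s h => stub_realises s.Z s.γ h.2 s.ω s.ω_algebraic b h.1
  choose rc hrc using hex
  let Θ : ℂ → PeriodSymbol → KZ.FormalRep := fun b s =>
    if h : IsAlgebraic ℚ b ∧ IsSemialgebraicMapOn ℚ {z : Fin 1 → ℝ | z 0 ∈ Set.Icc (0 : ℝ) 1}
        (fun z => Fin.append (fun i => (s.γ.toFun (z 0) i).re) (fun i => (s.γ.toFun (z 0) i).im))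
    then KZ.of (rc b s h) else 0
  have hΘ : ∀ b s (h : IsAlgebraic ℚ b ∧ IsSemialgebraicMapOn ℚ {z : Fin 1 → ℝ | z 0 ∈ Set.Icc (0 : ℝ) 1}
        (fun z => Fin.append (fun i => (s.γ.toFun (z 0) i).re) (fun i => (s.γ.toFun (z 0) i).im))),
      Θ b s = KZ.of (rc b s h) := fun b s h => dif_pos h
  have hΘ' : ∀ b s, ¬ (IsAlgebraic ℚ b ∧ IsSemialgebraicMapOn ℚ {z : Fin 1 → ℝ | z 0 ∈ Set.Icc (0 : ℝ) 1}
        (fun z => Fin.append (fun i => (s.γ.toFun (z 0) i).re) (fun i => (s.γ.toFun (z 0) i).im))) →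
      Θ b s = 0 := fun b s h => dif_neg h
  have hΘ0 : ∀ s, Θ 0 s ∈ M₁ := by
    intro s
    by_cases hs : IsSemialgebraicMapOn ℚ {z : Fin 1 → ℝ | z 0 ∈ Set.Icc (0 : ℝ) 1}
        (fun z => Fin.append (fun i => (s.γ.toFun (z 0) i).re) (fun i => (s.γ.toFun (z 0) i).im))
    · rw [hΘ 0 s ⟨isAlgebraic_zero, hs⟩]
      exact RetractionAlgebra.realises_zero_scalar _ s.ω _ (hrc 0 s ⟨isAlgebraic_zero, hs⟩)
    · rw [hΘ' 0 s (fun h => hs h.2)]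
      exact M₁.zero_mem
  have hΘadd : ∀ (s : PeriodSymbol) (b₁ b₂ : ℂ), IsAlgebraic ℚ b₁ → IsAlgebraic ℚ b₂ →
      Θ (b₁ + b₂) s - Θ b₁ s - Θ b₂ s ∈ M₁ := by
    intro s b₁ b₂ h₁ h₂
    by_cases hs : IsSemialgebraicMapOn ℚ {z : Fin 1 → ℝ | z 0 ∈ Set.Icc (0 : ℝ) 1}
        (fun z => Fin.append (fun i => (s.γ.toFun (z 0) i).re) (fun i => (s.γ.toFun (z 0) i).im))
    · rw [hΘ _ s ⟨h₁.add h₂, hs⟩, hΘ _ s ⟨h₁, hs⟩, hΘ _ s ⟨h₂, hs⟩]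
      exact RetractionAlgebra.realises_add_scalar _ s.ω b₁ b₂ _ _ _ (hrc _ s ⟨h₁.add h₂, hs⟩)
        (hrc _ s ⟨h₁, hs⟩) (hrc _ s ⟨h₂, hs⟩)
    · rw [hΘ' _ s (fun h => hs h.2), hΘ' _ s (fun h => hs h.2), hΘ' _ s (fun h => hs h.2)]
      simp
  set π : KZ.FormalRep →+ KZ.FormalRep ⧸ M₁ := QuotientAddGroup.mk' M₁ with hπ
  ------------------------------------------------------------------
  -- Step 1: cells, and arcs for every cell
  ------------------------------------------------------------------
  obtain ⟨N, hN, hcN⟩ := hcells c hc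
  have harc : ∀ ρ : KZ.IntegralRep 1, ∃ (C : PeriodSymbol →₀ ℂ) (R : PeriodSymbol → KZ.IntegralRep 1),
      ρ ∈ N.support →
      ((∀ s, IsAlgebraic ℚ (C s)) ∧
        (∀ s ∈ C.support, Ps s) ∧
        (∀ s ∈ C.support, IsSemialgebraicMapOn ℚ {z : Fin 1 → ℝ | z 0 ∈ Set.Icc (0 : ℝ) 1}
          (fun z => Fin.append (fun i => (s.γ.toFun (z 0) i).re) (fun i => (s.γ.toFun (z 0) i).im))) ∧
        (∀ s ∈ C.support, (R s).domain = {z | z 0 ∈ Set.Ioo (0 : ℝ) 1} ∧ ∀ z ∈ (R s).domain, (R s).integrand z =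
          (C s * ∑ i, MvPolynomial.eval (s.γ.toFun (z 0)) (s.ω i) * deriv (fun u => s.γ.toFun u i) (z 0)).re) ∧
        evalCombination C = ((ρ.value : ℝ) : ℂ) ∧ KZ.of ρ - ∑ s ∈ C.support, KZ.of (R s) ∈ M₁) := by
    intro ρ
    by_cases hρ : ρ ∈ N.support
    · obtain ⟨C, R, h⟩ := harcs ρ (hN ρ hρ)
      exact ⟨C, R, fun _ => h⟩
    · exact ⟨0, fun _ => ρ, fun h => absurd h hρ⟩
  choose Cf Rf hCf using harc
  ------------------------------------------------------------------
  -- Step 2: the combination `C = Σ_ρ N(ρ) • C_ρ` and the realisations `R`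
  ------------------------------------------------------------------
  set C : PeriodSymbol →₀ ℂ := ∑ ρ ∈ N.support, ((N ρ : ℤ) : ℂ) • Cf ρ with hCdef
  have hCalg : ∀ s, IsAlgebraic ℚ (C s) := fun s =>
    RetractionAlgebra.isAlgebraic_finset_sum_apply _ _ (fun ρ hρ s' => by
      rw [Finsupp.smul_apply, smul_eq_mul]
      exact (isAlgebraic_int (N ρ)).mul ((hCf ρ hρ).1 s')) s
  have hCsupp : ∀ s ∈ C.support, ∃ ρ ∈ N.support, s ∈ (Cf ρ).support := by
    intro s hs
    have h := Finsupp.support_finsetSum hs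
    simp only [Finset.mem_biUnion] at h
    obtain ⟨ρ, hρ, hsρ⟩ := h
    exact ⟨ρ, hρ, Finsupp.support_smul hsρ⟩
  have hCPs : ∀ s ∈ C.support, Ps s := by
    intro s hs
    obtain ⟨ρ, hρ, hsρ⟩ := hCsupp s hs
    exact (hCf ρ hρ).2.1 s hsρ
  have hCSA : ∀ s ∈ C.support, IsSemialgebraicMapOn ℚ {z : Fin 1 → ℝ | z 0 ∈ Set.Icc (0 : ℝ) 1}
      (fun z => Fin.append (fun i => (s.γ.toFun (z 0) i).re) (fun i => (s.γ.toFun (z 0) i).im)) := by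
    intro s hs
    obtain ⟨ρ, hρ, hsρ⟩ := hCsupp s hs
    exact (hCf ρ hρ).2.2.1 s hsρ
  let R : PeriodSymbol → KZ.IntegralRep 1 := fun s =>
    if h : IsAlgebraic ℚ (C s) ∧ IsSemialgebraicMapOn ℚ {z : Fin 1 → ℝ | z 0 ∈ Set.Icc (0 : ℝ) 1}
        (fun z => Fin.append (fun i => (s.γ.toFun (z 0) i).re) (fun i => (s.γ.toFun (z 0) i).im))
    then rc (C s) s h else Summit.KontsevichZagierPeriods.SymplecticScissors.RealOnePeriodRelationsNegative.constRep₁ 0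
  have hRΘ : ∀ s ∈ C.support, Θ (C s) s = KZ.of (R s) ∧
      ((R s).domain = {z | z 0 ∈ Set.Ioo (0 : ℝ) 1} ∧ ∀ z ∈ (R s).domain, (R s).integrand z =
        (C s * ∑ i, MvPolynomial.eval (s.γ.toFun (z 0)) (s.ω i) * deriv (fun u => s.γ.toFun u i) (z 0)).re) := by
    intro s hs
    have h : IsAlgebraic ℚ (C s) ∧ _ := ⟨hCalg s, hCSA s hs⟩
    have hR : R s = rc (C s) s h := dif_pos h
    rw [hΘ _ s h, hR]
    exact ⟨rfl, hrc _ s h⟩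
  ------------------------------------------------------------------
  -- Step 3: `π [ρ] = T(C_ρ)` for every cell
  ------------------------------------------------------------------
  have hTρ : ∀ ρ ∈ N.support, π (KZ.of ρ) = π ((Cf ρ).sum fun s b => Θ b s) := by
    intro ρ hρ
    obtain ⟨hCa, -, hCs, hCr, -, hsub⟩ := hCf ρ hρ
    rw [RetractionAlgebra.mk_sum_eq_sum_superset Θ hΘ0 (Cf ρ) (Finset.Subset.refl _)]
    -- `[ρ] ≡ Σ [R_ρ s] ≡ Σ Θ (C_ρ s) s`
    have h1 : π (KZ.of ρ) = ∑ s ∈ (Cf ρ).support, π (KZ.of (Rf ρ s)) := by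
      rw [← map_sum, ← sub_eq_zero, ← map_sub, NormalisationGlue.mk'_eq_zero_iff]
      exact hsub
    rw [h1]
    refine Finset.sum_congr rfl fun s hs => ?_
    rw [← sub_eq_zero, ← map_sub, NormalisationGlue.mk'_eq_zero_iff, hΘ _ s ⟨hCa s, hCs s hs⟩]
    exact RetractionAlgebra.realises_unique s.γ.toFun s.ω _ _ _ (hCr s hs) (hrc _ s ⟨hCa s, hCs s hs⟩)
  ------------------------------------------------------------------
  -- Step 4: `T` of an integer multiple
  ------------------------------------------------------------------
  have hTsmul : ∀ ρ ∈ N.support, π ((((N ρ : ℤ) : ℂ) • Cf ρ).sum fun s b => Θ b s) =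
      (N ρ : ℤ) • π ((Cf ρ).sum fun s b => Θ b s) := by
    intro ρ hρ
    obtain ⟨hCa, -, -, -, -, -⟩ := hCf ρ hρ
    have hS : (((N ρ : ℤ) : ℂ) • Cf ρ).support ⊆ (Cf ρ).support := Finsupp.support_smul
    rw [RetractionAlgebra.mk_sum_eq_sum_superset Θ hΘ0 _ hS,
      RetractionAlgebra.mk_sum_eq_sum_superset Θ hΘ0 (Cf ρ) (Finset.Subset.refl _), Finset.smul_sum]
    refine Finset.sum_congr rfl fun s _ => ?_
    rw [Finsupp.smul_apply, smul_eq_mul]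
    exact NormalisationGlue.mk_Θ_intMul Θ hΘ0 hΘadd s (hCa s) (N ρ)
  ------------------------------------------------------------------
  -- Step 5: `c ≡ Σ_{s ∈ supp C} [R s]`
  ------------------------------------------------------------------
  have hmain : c - ∑ s ∈ C.support, KZ.of (R s) ∈ M₁ := by
    rw [← NormalisationGlue.mk'_eq_zero_iff, map_sub, sub_eq_zero]
    -- left: `π c = Σ_ρ N ρ • π [ρ]`
    have hc' : π c = ∑ ρ ∈ N.support, (N ρ : ℤ) • π (KZ.of ρ) := by
      have h := hcN
      rw [← NormalisationGlue.mk'_eq_zero_iff, map_sub, sub_eq_zero] at h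
      rw [h, Finsupp.sum, map_sum]
      exact Finset.sum_congr rfl fun ρ _ => by rw [map_zsmul]
    -- right: `π (Σ [R s]) = T C`
    have hT : π (∑ s ∈ C.support, KZ.of (R s)) = π (C.sum fun s b => Θ b s) := by
      rw [RetractionAlgebra.mk_sum_eq_sum_superset Θ hΘ0 C (Finset.Subset.refl _), map_sum]
      exact Finset.sum_congr rfl fun s hs => by rw [(hRΘ s hs).1]
    rw [hc', hT, hCdef,
      RetractionAlgebra.mk_sum_finset_sum Θ hΘ0 hΘadd N.support _ (fun ρ hρ s => by
        rw [Finsupp.smul_apply, smul_eq_mul]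
        exact (isAlgebraic_int (N ρ)).mul ((hCf ρ hρ).1 s))]
    exact Finset.sum_congr rfl fun ρ hρ => by rw [hTρ ρ hρ, hTsmul ρ hρ]
  ------------------------------------------------------------------
  -- Step 6: the value
  ------------------------------------------------------------------
  have heval : evalCombination C = ((KZ.eval c : ℝ) : ℂ) := by
    have h1 : KZ.eval c = KZ.eval (N.sum fun ρ m => m • KZ.of ρ) := by
      have := eval_eq_zero_of_mem_M₁ hcN
      rwa [map_sub, sub_eq_zero] at this
    rw [h1, Finsupp.sum, map_sum, hCdef, NormalisationGlue.evalCombination_finset_sum]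
    push_cast
    refine Finset.sum_congr rfl fun ρ hρ => ?_
    rw [evalCombination_smul, (hCf ρ hρ).2.2.2.2.1, map_zsmul, KZ.eval_of, zsmul_eq_mul]
    push_cast
    ring
  exact ⟨C, R, hCalg, hCPs, hCSA, fun s hs => (hRΘ s hs).2, heval, hmain⟩

end RationalLayer

end Summit.KontsevichZagierPeriods.SymplecticScissors.RealOnePeriodRelations

end
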